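import Summits.Ventures.LatticeQCDFlow.Scoring.UNWilsonLoopSecondMoment2D
import Mathlib.Analysis.SpecificLimits.Normed
import HarnessLib

/-!
# Bounds and large-area limit of the Wilson-loop second moment in two-dimensional `U(N)`: `−1/(N²−1) < P_adj(β) < 1`, `⟨|tr W_{R×T}|²⟩_β → 1`

HONEST FRAMING: exact (Metropolis-corrected) sampling algorithms for lattice gauge theory;
figures of merit are autocorrelation/cost numbers at stated couplings and volumes; no
continuum-physics claim.

Venture `LatticeQCDFlow` (cell pub-lqcd), sub-topic `Scoring`; FANOUT row 5 (`s0-sun-a`), GEN-21.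
NEW WORK of the cell (placement rule).  GEN-21's `UNWilsonLoopSecondMoment2D` gives the closed form
`⟨|tr W_{R×T}|²⟩_β = 1 + (N² − 1)·P_adj(β)^{RT}` with `P_adj(β) = (M₂/D − 1)/(N² − 1)`, `M₂ = ∫|tr u|²e^{βRe tr u}du`,
`D = det[I_{|i−j|}(β)] = ∫e^{βRe tr u}du`.  Here the normalised adjoint plaquette is located STRICTLY inside
`(−1/(N²−1), 1)` for every real `β` and `N ≥ 2` — `0 < M₂ < N²·D` because `0 ≤ |tr u|² ≤ N²` with each inequality
strict on a set of positive Haar measure — so `|P_adj(β)| < 1` and the second moment DECORRELATES to its Haar value: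

* `unitary_normSq_trace_weight_pos`, `unitary_normSq_trace_weight_lt` — `0 < M₂ < N²·D`;
* **`unitary_adjointPlaquette_mem_Ioo`** — `−1/(N²−1) < P_adj(β) < 1`, hence **`abs_unitary_adjointPlaquette_lt_one`**;
* **`tendsto_unitary_wilsonLoop_secondMoment`** — `1 + (N²−1)·P_adj(β)ⁿ → 1` as the area `n = RT → ∞` (the sequence of
  exact values of `⟨|tr W_{R×T}|²⟩_β`; geometric rate `|P_adj|ⁿ`).

No `def`, nothing cited as a fact, 0 sorry.
-/

noncomputable section

open MeasureTheory Filter Topology Finset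
open Literature.MathematicalPhysics.QuantumFieldTheory
open Literature.Analysis.FunctionSpaces (besselI)

namespace Summit.Ventures.LatticeQCDFlow.Scoring

section Bounds

variable {N : ℕ}

/-- `|tr u|² ≤ N²` for `u ∈ U(N)` (entries of modulus `≤ 1`). -/
theorem normSq_trace_le_sq_card (u : Matrix.unitaryGroup (Fin N) ℂ) :
    ‖((u : Matrix.unitaryGroup (Fin N) ℂ) : Matrix (Fin N) (Fin N) ℂ).trace‖ ^ 2 ≤ (N : ℝ) ^ 2 := by
  have h : ‖((u : Matrix.unitaryGroup (Fin N) ℂ) : Matrix (Fin N) (Fin N) ℂ).trace‖ ≤ N := by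
    calc ‖((u : Matrix.unitaryGroup (Fin N) ℂ) : Matrix (Fin N) (Fin N) ℂ).trace‖
        = ‖∑ i, ((u : Matrix.unitaryGroup (Fin N) ℂ) : Matrix (Fin N) (Fin N) ℂ) i i‖ := by rw [Matrix.trace]; rfl
      _ ≤ ∑ i, ‖((u : Matrix.unitaryGroup (Fin N) ℂ) : Matrix (Fin N) (Fin N) ℂ) i i‖ := norm_sum_le _ _
      _ ≤ ∑ _i : Fin N, (1 : ℝ) := Finset.sum_le_sum fun i _ => entry_norm_bound_of_unitary u.2 i i
      _ = N := by simp
  exact pow_le_pow_left₀ (norm_nonneg _) h 2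

/-- The weighted second moment is integrable data: `u ↦ |tr u|² e^{βRe tr u}` is continuous on the compact `U(N)`. -/
theorem continuous_normSq_trace_mul_weight (β : ℝ) :
    Continuous fun u : Matrix.unitaryGroup (Fin N) ℂ =>
      ‖((u : Matrix.unitaryGroup (Fin N) ℂ) : Matrix (Fin N) (Fin N) ℂ).trace‖ ^ 2 *
        Real.exp (β * ((u : Matrix.unitaryGroup (Fin N) ℂ) : Matrix (Fin N) (Fin N) ℂ).trace.re) := by
  have htr : Continuous fun u : Matrix.unitaryGroup (Fin N) ℂ =>
      ((u : Matrix.unitaryGroup (Fin N) ℂ) : Matrix (Fin N) (Fin N) ℂ).trace :=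
    continuous_subtype_val.matrix_trace
  exact (htr.norm.pow 2).mul (Real.continuous_exp.comp (continuous_const.mul (Complex.continuous_re.comp htr)))

/-- **`M₂ < N²·D`**: `∫|tr u|²e^{βRe tr u}du < N²·det[I_{|i−j|}(β)]` (`N ≥ 2`; the deficit `N² − |tr u|²` is
non-negative, continuous, and positive at `u = diag(−1, 1, …, 1)`, a point of the support of Haar measure). -/
theorem unitary_normSq_trace_weight_lt (hN : 2 ≤ N) (β : ℝ) :
    (∫ u, ‖((u : Matrix.unitaryGroup (Fin N) ℂ) : Matrix (Fin N) (Fin N) ℂ).trace‖ ^ 2 *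
        Real.exp (β * ((u : Matrix.unitaryGroup (Fin N) ℂ) : Matrix (Fin N) (Fin N) ℂ).trace.re)
        ∂(haarProbability (Matrix.unitaryGroup (Fin N) ℂ))) <
      (N : ℝ) ^ 2 * (Matrix.of fun i j : Fin N => besselI ((i : ℤ) - (j : ℤ)).natAbs β).det := by
  haveI : NeZero N := ⟨by omega⟩
  haveI : (haarProbability (Matrix.unitaryGroup (Fin N) ℂ)).IsHaarMeasure := Measure.isHaarMeasure_haarMeasure ⊤
  set μ := haarProbability (Matrix.unitaryGroup (Fin N) ℂ) with hμ
  have htr : Continuous fun u : Matrix.unitaryGroup (Fin N) ℂ =>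
      ((u : Matrix.unitaryGroup (Fin N) ℂ) : Matrix (Fin N) (Fin N) ℂ).trace :=
    continuous_subtype_val.matrix_trace
  have hw : Continuous fun u : Matrix.unitaryGroup (Fin N) ℂ =>
      Real.exp (β * ((u : Matrix.unitaryGroup (Fin N) ℂ) : Matrix (Fin N) (Fin N) ℂ).trace.re) :=
    Real.continuous_exp.comp (continuous_const.mul (Complex.continuous_re.comp htr))
  -- the deficit integrand
  set g : Matrix.unitaryGroup (Fin N) ℂ → ℝ := fun u =>
    ((N : ℝ) ^ 2 - ‖((u : Matrix.unitaryGroup (Fin N) ℂ) : Matrix (Fin N) (Fin N) ℂ).trace‖ ^ 2) *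
      Real.exp (β * ((u : Matrix.unitaryGroup (Fin N) ℂ) : Matrix (Fin N) (Fin N) ℂ).trace.re) with hg
  have hgc : Continuous g := (continuous_const.sub (htr.norm.pow 2)).mul hw
  have hg_int : Integrable g μ := hgc.integrable_of_hasCompactSupport (HasCompactSupport.of_compactSpace _)
  have hg_nonneg : ∀ u, 0 ≤ g u := fun u =>
    mul_nonneg (sub_nonneg.2 (normSq_trace_le_sq_card u)) (Real.exp_pos _).le
  -- positivity of the deficit: the open set `{|tr u|² < N²}` contains `diag(−1, 1, …, 1)`
  have hopen : IsOpen {u : Matrix.unitaryGroup (Fin N) ℂ |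
      ‖((u : Matrix.unitaryGroup (Fin N) ℂ) : Matrix (Fin N) (Fin N) ℂ).trace‖ ^ 2 < (N : ℝ) ^ 2} :=
    isOpen_lt (htr.norm.pow 2) continuous_const
  set d : Fin N → ℂ := fun a => if a = (0 : Fin N) then -1 else 1 with hd
  have hdU : Matrix.diagonal d ∈ Matrix.unitaryGroup (Fin N) ℂ := by
    rw [Matrix.mem_unitaryGroup_iff, Matrix.star_eq_conjTranspose, Matrix.diagonal_conjTranspose,
      Matrix.diagonal_mul_diagonal, ← Matrix.diagonal_one]
    congr 1; funext a; by_cases h : a = (0 : Fin N) <;> simp [hd, h]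
  have htrd : (Matrix.diagonal d).trace = (N : ℂ) - 2 := by
    have e : ∀ a : Fin N, (if a = (0 : Fin N) then (-1 : ℂ) else 1) = 1 - (if a = (0 : Fin N) then 2 else 0) := by
      intro a; split_ifs <;> norm_num
    rw [Matrix.trace_diagonal]
    simp_rw [hd, e]
    rw [Finset.sum_sub_distrib, Finset.sum_const, Finset.card_univ, Fintype.card_fin, Finset.sum_ite_eq' Finset.univ
      (0 : Fin N) (fun _ => (2 : ℂ)), if_pos (Finset.mem_univ _), nsmul_eq_mul, mul_one]
  have hpos : 0 < μ {u : Matrix.unitaryGroup (Fin N) ℂ |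
      ‖((u : Matrix.unitaryGroup (Fin N) ℂ) : Matrix (Fin N) (Fin N) ℂ).trace‖ ^ 2 < (N : ℝ) ^ 2} := by
    refine hopen.measure_pos μ ⟨⟨Matrix.diagonal d, hdU⟩, ?_⟩
    simp only [Set.mem_setOf_eq]
    rw [htrd, show ((N : ℂ) - 2) = (((N : ℝ) - 2 : ℝ) : ℂ) by push_cast; rfl, Complex.norm_real,
      Real.norm_eq_abs, sq_abs]
    have h2 : (2 : ℝ) ≤ N := by exact_mod_cast hN
    nlinarith
  have hgap : 0 < ∫ u, g u ∂μ := by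
    rw [integral_pos_iff_support_of_nonneg hg_nonneg hg_int]
    refine hpos.trans_le (measure_mono fun u hu => ?_)
    simp only [Set.mem_setOf_eq] at hu
    simp only [Function.mem_support, hg]
    exact (mul_pos (sub_pos.2 hu) (Real.exp_pos _)).ne'
  -- `∫ g = N² D − M₂`
  have hM2_int : Integrable (fun u : Matrix.unitaryGroup (Fin N) ℂ =>
      ‖((u : Matrix.unitaryGroup (Fin N) ℂ) : Matrix (Fin N) (Fin N) ℂ).trace‖ ^ 2 *
        Real.exp (β * ((u : Matrix.unitaryGroup (Fin N) ℂ) : Matrix (Fin N) (Fin N) ℂ).trace.re)) μ :=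
    (continuous_normSq_trace_mul_weight β).integrable_of_hasCompactSupport (HasCompactSupport.of_compactSpace _)
  have hw_int : Integrable (fun u : Matrix.unitaryGroup (Fin N) ℂ =>
      Real.exp (β * ((u : Matrix.unitaryGroup (Fin N) ℂ) : Matrix (Fin N) (Fin N) ℂ).trace.re)) μ :=
    hw.integrable_of_hasCompactSupport (HasCompactSupport.of_compactSpace _)
  have hsplit : ∫ u, g u ∂μ = (N : ℝ) ^ 2 * (Matrix.of fun i j : Fin N => besselI ((i : ℤ) - (j : ℤ)).natAbs β).det -
      ∫ u, ‖((u : Matrix.unitaryGroup (Fin N) ℂ) : Matrix (Fin N) (Fin N) ℂ).trace‖ ^ 2 *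
        Real.exp (β * ((u : Matrix.unitaryGroup (Fin N) ℂ) : Matrix (Fin N) (Fin N) ℂ).trace.re) ∂μ := by
    rw [← integral_haar_unitaryGroup_fin_exp_mul_trace_re N β, ← integral_const_mul, ← integral_sub (hw_int.const_mul _) hM2_int]
    exact integral_congr_ae (ae_of_all _ fun u => by simp only [hg]; ring)
  linarith [hgap, hsplit]

/-- **`0 < M₂`**: `0 < ∫|tr u|²e^{βRe tr u}du` (`N ≥ 1`; the integrand is non-negative, continuous and positive at `u = 1`). -/
theorem unitary_normSq_trace_weight_pos (hN : 1 ≤ N) (β : ℝ) :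
    0 < ∫ u, ‖((u : Matrix.unitaryGroup (Fin N) ℂ) : Matrix (Fin N) (Fin N) ℂ).trace‖ ^ 2 *
        Real.exp (β * ((u : Matrix.unitaryGroup (Fin N) ℂ) : Matrix (Fin N) (Fin N) ℂ).trace.re)
        ∂(haarProbability (Matrix.unitaryGroup (Fin N) ℂ)) := by
  haveI : NeZero N := ⟨by omega⟩
  haveI : (haarProbability (Matrix.unitaryGroup (Fin N) ℂ)).IsHaarMeasure := Measure.isHaarMeasure_haarMeasure ⊤
  set μ := haarProbability (Matrix.unitaryGroup (Fin N) ℂ) with hμ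
  have htr : Continuous fun u : Matrix.unitaryGroup (Fin N) ℂ =>
      ((u : Matrix.unitaryGroup (Fin N) ℂ) : Matrix (Fin N) (Fin N) ℂ).trace :=
    continuous_subtype_val.matrix_trace
  have hint : Integrable (fun u : Matrix.unitaryGroup (Fin N) ℂ =>
      ‖((u : Matrix.unitaryGroup (Fin N) ℂ) : Matrix (Fin N) (Fin N) ℂ).trace‖ ^ 2 *
        Real.exp (β * ((u : Matrix.unitaryGroup (Fin N) ℂ) : Matrix (Fin N) (Fin N) ℂ).trace.re)) μ :=
    (continuous_normSq_trace_mul_weight (N := N) β).integrable_of_hasCompactSupport (HasCompactSupport.of_compactSpace _)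
  have hnonneg : ∀ u : Matrix.unitaryGroup (Fin N) ℂ, 0 ≤ ‖((u : Matrix.unitaryGroup (Fin N) ℂ) : Matrix (Fin N) (Fin N) ℂ).trace‖ ^ 2 *
      Real.exp (β * ((u : Matrix.unitaryGroup (Fin N) ℂ) : Matrix (Fin N) (Fin N) ℂ).trace.re) :=
    fun u => mul_nonneg (sq_nonneg _) (Real.exp_pos _).le
  have hopen : IsOpen {u : Matrix.unitaryGroup (Fin N) ℂ |
      0 < ‖((u : Matrix.unitaryGroup (Fin N) ℂ) : Matrix (Fin N) (Fin N) ℂ).trace‖ ^ 2} :=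
    isOpen_lt continuous_const (htr.norm.pow 2)
  have hpos : 0 < μ {u : Matrix.unitaryGroup (Fin N) ℂ |
      0 < ‖((u : Matrix.unitaryGroup (Fin N) ℂ) : Matrix (Fin N) (Fin N) ℂ).trace‖ ^ 2} := by
    refine hopen.measure_pos μ ⟨1, ?_⟩
    simp only [Set.mem_setOf_eq]
    rw [show (((1 : Matrix.unitaryGroup (Fin N) ℂ)) : Matrix (Fin N) (Fin N) ℂ) = 1 from rfl, Matrix.trace_one,
      Fintype.card_fin, Complex.norm_natCast]
    have h1 : (1 : ℝ) ≤ N := by exact_mod_cast hN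
    positivity
  rw [integral_pos_iff_support_of_nonneg hnonneg hint]
  refine hpos.trans_le (measure_mono fun u hu => ?_)
  simp only [Set.mem_setOf_eq] at hu
  simp only [Function.mem_support]
  exact (mul_pos hu (Real.exp_pos _)).ne'

/-- **`−1/(N²−1) < P_adj(β) < 1`** for every real `β` and `N ≥ 2`. -/
theorem unitary_adjointPlaquette_mem_Ioo (hN : 2 ≤ N) (β : ℝ) :
    ((∫ u, ‖((u : Matrix.unitaryGroup (Fin N) ℂ) : Matrix (Fin N) (Fin N) ℂ).trace‖ ^ 2 *
          Real.exp (β * ((u : Matrix.unitaryGroup (Fin N) ℂ) : Matrix (Fin N) (Fin N) ℂ).trace.re)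
          ∂(haarProbability (Matrix.unitaryGroup (Fin N) ℂ))) /
        (Matrix.of fun i j : Fin N => besselI ((i : ℤ) - (j : ℤ)).natAbs β).det - 1) / ((N : ℝ) ^ 2 - 1)
      ∈ Set.Ioo (-1 / ((N : ℝ) ^ 2 - 1)) 1 := by
  have hD := det_besselI_toeplitz_fin_pos N β
  have hN1 : 0 < ((N : ℝ) ^ 2 - 1) := by
    have h2 : (2 : ℝ) ≤ N := by exact_mod_cast hN
    nlinarith
  have hlt := unitary_normSq_trace_weight_lt hN β
  have hpos := unitary_normSq_trace_weight_pos (N := N) (by omega) β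
  constructor
  · rw [div_lt_div_iff_of_pos_right hN1]
    have : 0 < (∫ u, ‖((u : Matrix.unitaryGroup (Fin N) ℂ) : Matrix (Fin N) (Fin N) ℂ).trace‖ ^ 2 *
          Real.exp (β * ((u : Matrix.unitaryGroup (Fin N) ℂ) : Matrix (Fin N) (Fin N) ℂ).trace.re)
          ∂(haarProbability (Matrix.unitaryGroup (Fin N) ℂ))) /
        (Matrix.of fun i j : Fin N => besselI ((i : ℤ) - (j : ℤ)).natAbs β).det := div_pos hpos hD
    linarith
  · rw [div_lt_one hN1, sub_lt_iff_lt_add, div_lt_iff₀ hD]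
    linarith

/-- **`|P_adj(β)| < 1`** (`N ≥ 2`). -/
theorem abs_unitary_adjointPlaquette_lt_one (hN : 2 ≤ N) (β : ℝ) :
    |((∫ u, ‖((u : Matrix.unitaryGroup (Fin N) ℂ) : Matrix (Fin N) (Fin N) ℂ).trace‖ ^ 2 *
          Real.exp (β * ((u : Matrix.unitaryGroup (Fin N) ℂ) : Matrix (Fin N) (Fin N) ℂ).trace.re)
          ∂(haarProbability (Matrix.unitaryGroup (Fin N) ℂ))) /
        (Matrix.of fun i j : Fin N => besselI ((i : ℤ) - (j : ℤ)).natAbs β).det - 1) / ((N : ℝ) ^ 2 - 1)| < 1 := by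
  obtain ⟨h1, h2⟩ := unitary_adjointPlaquette_mem_Ioo hN β
  have hN1 : 1 ≤ ((N : ℝ) ^ 2 - 1) := by
    have h2' : (2 : ℝ) ≤ N := by exact_mod_cast hN
    nlinarith
  rw [abs_lt]
  refine ⟨lt_of_le_of_lt ?_ h1, h2⟩
  rw [le_div_iff₀ (by linarith), neg_mul, one_mul, neg_le_neg_iff]
  exact hN1

/-- **THE SECOND MOMENT DECORRELATES**: the exact values `1 + (N² − 1)·P_adj(β)ⁿ` of `⟨|tr W_{R×T}|²⟩_β` at area
`n = RT` tend to the Haar value `1` as `n → ∞`, for every real `β` and `N ≥ 2`. -/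
theorem tendsto_unitary_wilsonLoop_secondMoment (hN : 2 ≤ N) (β : ℝ) :
    Tendsto (fun n : ℕ => 1 + ((N : ℝ) ^ 2 - 1) *
      (((∫ u, ‖((u : Matrix.unitaryGroup (Fin N) ℂ) : Matrix (Fin N) (Fin N) ℂ).trace‖ ^ 2 *
          Real.exp (β * ((u : Matrix.unitaryGroup (Fin N) ℂ) : Matrix (Fin N) (Fin N) ℂ).trace.re)
          ∂(haarProbability (Matrix.unitaryGroup (Fin N) ℂ))) /
        (Matrix.of fun i j : Fin N => besselI ((i : ℤ) - (j : ℤ)).natAbs β).det - 1) / ((N : ℝ) ^ 2 - 1)) ^ n)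
      atTop (𝓝 1) := by
  have h := abs_unitary_adjointPlaquette_lt_one hN β
  have ht := (tendsto_pow_atTop_nhds_zero_of_abs_lt_one h).const_mul ((N : ℝ) ^ 2 - 1)
  rw [mul_zero] at ht
  simpa using ht.const_add 1

end Bounds

end Summit.Ventures.LatticeQCDFlow.Scoring
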